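import Summits.BirchSwinnertonDyer.Rank1Residual.P2.WindowsAtTwo
import Summits.BirchSwinnertonDyer.Rank1Residual.X12.CMRungLeaves
import Summits.BirchSwinnertonDyer.Rank1Residual.X12.CongruentNumberOddPart
import Summits.BirchSwinnertonDyer.Rank1Residual.WAll.Target
import Literature.NumberTheory.EllipticCurves.BSDpVariableChangeProofs
import HarnessLib

/-!
# Leaf CornerF @ `p = 2` — THE DISCHARGE INTERFACE (cell `bsd-print-cf2`, D-0131 (2) print tier,
# typer ty2): leaf predicate ⟹ the binders of the typed print theorems, fact-free, so that the
# provers close class theorems BY NAME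

HONEST FRAMING (cell `bsd-print-cf2`, HOME `run/shared/lean/pub/bsd-print-cf2/`, verbatim in every
file): the partition leaf is `CornerF W 2` of `Partition/CornersCM.lean` — `W/ℚ` globally minimal
elliptic WITH CM and `ord_{s=1} L(E,s) = 1`, at the prime `2` (rung leaf `WAllCornerFTwo`, K7t row
B14; `0` census cells; OPEN AS A CLASS: no theorem in print decides `BSD(E,2)` for every such `E`).
What print DOES decide is `BSD(E,2)` on explicit infinite FAMILIES inside the leaf, typed elsewhere in
the tree AS PRINTED and ON NAMED MODELS: Li–Liu–Tian 2024 Thm. 1.2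
(`LiLiuTian2024.thm12_bsd_congruentNumberCurve`, full BSD for `E_n : y² = x³ − n²x`, `n ≡ 5 (8)`
square-free, all `q ∣ n` with `q ≡ 1 (4)`, no ideal class of order `4` in `ℚ(√−n)`), Tian 2014
Thm. 1.3 (`Tian2014.thm13_rank_one_and_sha_odd`) with Tian–Yuan–Zhang 2017 Thms. 1.1/1.2
(`TianYuanZhang2017.thm11_parity_of_scriptL`, `thm12_parity_of_scriptL'`) on Tian's three classes
(`Tian2014/Class{Five,Six,Seven}FamilyDescentProofs.lean`, doors `P2/TianFamily{,Seven}AtTwo.lean`),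
all on `congruentNumberCurve n`; and, for the cube-sum companions `C_p : x³ + y³ = p`, NOTHING at `2`
(rung leaf `X12.CMAtTwo`, typed on models of `cubeSumCurve p`). This file asserts NO arithmetic fact,
introduces NO definition and NO named fact (D-0026): it is the GLUE between the leaf's currency
(an ARBITRARY globally minimal `W` with `CornerF W 2`) and the named models the facts speak about —
every theorem is fact-free unless a typed print fact appears among its binders, and then that fact
is the ONLY non-kernel input (no Gross–Zagier–Kolyvagin, no Cassels, no modularity: the model
transport is the fact-free `WeierstrassCurve.bsdp_iff_of_smul_eq_of_isGloballyMinimal`, p532483).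

## Contents (what a prover of the cell composes with)

* §0 The leaf in normal form: `cornerF_two_iff : CornerF W 2 ↔ W.HasCM ∧ W.analyticRank = 1`;
  `wAllCornerFTwo_iff_cornerF : WAllCornerFTwo ↔ ∀ W, CornerF W 2 → BSDp W 2`.
* §1 S2 companions (`E_n`, CM by `ℤ[i]`, `2` RAMIFIED): for `W` globally minimal with
  `C • W = congruentNumberCurve n`, `n` square-free — `analyticRank_eq`, `hasCM`, `cmRamified_two`,
  `not_good_two`, `cornerF_two_iff` (`CornerF W 2 ↔ r_an(E_n) = 1`), and the fact-free transport
  `bsdp_iff` / `forall_bsdp_iff` (`BSDp W p ↔ BSDp (congruentNumberCurve n) p`). Hence the binders of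
  every typed `E_n`-fact are reached from the leaf by: the family's arithmetic conditions on `n`
  (kernel-decidable per class, or family hypotheses) + the class-group hypothesis in certificate form
  (`QuadraticFields/RedeiReichardtCertificates.lean`: `condition11_of_card_ker`,
  `noIdealClassOfOrderFour_of_card_ker`, Rédei–Reichardt DISCHARGED) + the quadratic field witness
  `GenusField d` (`isQuadraticFieldOfSqrt_genusField`). Worked closure in LEAF SHAPE with ONE fact:
  `bsdp_two_of_cornerF_of_congruentFamilyLLT` (Li–Liu–Tian Thm. 1.2 ⇒ the leaf on the LLT family),
  and `bsdTwoOn_congruentFamilyLLT'` (the sub-lane's class door with its three transport facts removed);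
  square-free normalisation `CongruentNumber.exists_smul_congruentNumberCurve_of_smul_eq_neg_sq`
  (`C • W = y² = x³ − m²x`, `m ∈ ℚˣ` ⟹ `W` is a model of `E_n` with `n` SQUARE-FREE, as the facts need).
* §2 S2b companions (`C_p`, CM by `ℤ[ζ₃]`, `2` INERT): for `B` globally minimal with
  `C • B = cubeSumCurve p`, `p` prime `≠ 3` — `cornerF_two_iff` (`CornerF B 2 ↔ r_an = 1`; inertness of `2` is
  the landed `X12.Sylvester.not_cmSplit_two_of_model`),
  the fact-free transport to the named minimal model `X12.Sylvester.sylvesterCurve p`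
  (`bsdp_iff_sylvesterCurve`), and the rung leaf K7t REDUCED TO THE NAMED MODEL:
  `cmAtTwo_iff_sylvesterCurve : X12.CMAtTwo ↔ ∀ p, … → BSDp (sylvesterCurve p) 2`.
* §3 (docstring pointers only, nothing restated) the leaf split by the behaviour of `2` in `K`:
  `Partition/CornersCMDecide.lean` (`cmRamified_two_iff_of_hasCM`: `d_K ∈ {−4, −8}`;
  `cmInert_two_iff_of_hasCM`: `d_K ∈ {−3, −11, −19, −43, −67, −163}`; split iff `d_K = −7`, whose
  good-ordinary sub-cell is CLOSED in print by Li–Tian–Yan–Zhu 2025, `WAll.cornerF_two_goodOrd_of_LTYZ`).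

References: [Miller2011LMS] Def. 1.1; [LiLiuTian2024] Thm. 1.2; [Tian2014] Thm. 1.3, Rem. 1.4;
[TianYuanZhang2017] Thms. 1.1/1.2; [Tian2023CongruentICM] Thm. 2, p. 1993 (the `2`-part attribution),
Thm. 8; [HuShuYin2019] Thm. 1.4; HOME/README.md (cell charter); `Partition/CornersCM.lean`,
`WAll/Target.lean`, `X12/CMRungLeaves.lean`, `P2/WindowsAtTwo.lean`, `X12/CubeSumSylvesterOddPart.lean`.
-/

noncomputable section

open scoped Classical

open WeierstrassCurve Literature.NumberTheory.EllipticCurves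
  Literature.NumberTheory.EllipticCurves.Rank1Residual
  Literature.NumberTheory.EllipticCurves.Rank1Residual.Typed
  Literature.NumberTheory.EllipticCurves.HuShuYin2019

set_option autoImplicit false

namespace Summit.BirchSwinnertonDyer.Rank1Residual.P2.CornerFTwo

/-! ## §0 The leaf in normal form -/

section Leaf

variable {W : WeierstrassCurve ℚ} [W.IsElliptic]

/-- **The leaf CornerF at `p = 2` is "CM and analytic rank one"** (the `p = 2` disjunct of
`CornerF` is `rfl`). [folklore] -/
theorem cornerF_two_iff : CornerF W 2 ↔ W.HasCM ∧ W.analyticRank = 1 :=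
  ⟨fun h => ⟨h.1, h.2.1⟩, fun h => ⟨h.1, h.2, Or.inl rfl⟩⟩

/-- For a CM curve: `CornerF W 2 ↔ r_an = 1`. [folklore] -/
theorem cornerF_two_iff_of_hasCM (hcm : W.HasCM) : CornerF W 2 ↔ W.analyticRank = 1 := by
  rw [cornerF_two_iff]; exact ⟨fun h => h.2, fun h => ⟨hcm, h⟩⟩

/-- **The leaf predicate at `2` is a `ℚ`-isomorphism invariant**: for elliptic `W₀`, `W` with
`C • W₀ = W`, `CornerF W 2 ↔ CornerF W₀ 2` (`j` and the analytic rank are invariant: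
`variableChange_j`, `hasCM_iff_of_j_eq`, `analyticRank_variableChange_holds`). Together with
`WeierstrassCurve.bsdp_iff_of_smul_eq_of_isGloballyMinimal` the whole leaf statement
`CornerF · 2 → BSDp · 2` moves between globally minimal models fact-free. [folklore] -/
theorem cornerF_two_iff_of_smul_eq {W₀ : WeierstrassCurve ℚ} [W₀.IsElliptic] {C : VariableChange ℚ}
    (hC : C • W₀ = W) : CornerF W 2 ↔ CornerF W₀ 2 := by
  subst hC
  rw [cornerF_two_iff, cornerF_two_iff, hasCM_iff_of_j_eq (variableChange_j W₀ C),
    analyticRank_variableChange_holds W₀ C]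

end Leaf

/-- **Rung leaf `WAllCornerFTwo` ⟺ the partition leaf at `2`**: `∀ W, HasCM → r_an = 1 → BSD(E,2)`
iff `∀ W, CornerF W 2 → BSD(E,2)`. [folklore] -/
theorem wAllCornerFTwo_iff_cornerF :
    WAllCornerFTwo ↔
      ∀ (W : WeierstrassCurve ℚ) [W.IsElliptic] [W.IsGloballyMinimal], CornerF W 2 → BSDp W 2 :=
  ⟨fun h W _ _ hF => h W hF.1 hF.2.1, fun h W _ _ hcm hr => h W ⟨hcm, hr, Or.inl rfl⟩⟩

/-! ## §1 S2 companions: globally minimal models of the congruent-number curves `E_n` -/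

namespace CongruentNumber

variable {n : ℕ} {W : WeierstrassCurve ℚ} [W.IsElliptic]

/-! Membership is written in the tree in two orientations: `C • congruentNumberCurve n = W`
(`P2.CongruentFamilyLLT`, the cell's p1 slices) and `C • W = congruentNumberCurve n`
(`X12.CongruentNumber.*`). Both are served; the unprimed lemmas take the first. -/

omit [W.IsElliptic] in
/-- The two orientations of "`W` is a `ℚ`-model of `E_n`" are equivalent (`C ↦ C⁻¹`). [folklore] -/
theorem exists_smul_eq_comm :
    (∃ C : VariableChange ℚ, C • congruentNumberCurve n = W) ↔
      ∃ C : VariableChange ℚ, C • W = congruentNumberCurve n := by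
  constructor
  · rintro ⟨C, hC⟩
    exact ⟨C⁻¹, by rw [← hC, inv_smul_smul]⟩
  · rintro ⟨C, hC⟩
    exact ⟨C⁻¹, by rw [← hC, inv_smul_smul]⟩

omit [W.IsElliptic] in
/-- A model `W` of `E_n` (`C • E_n = W`) has the analytic rank of `E_n` (isomorphism invariance,
`analyticRank_variableChange_holds`; `n ≠ 0` so that `E_n` is elliptic). [folklore] -/
theorem analyticRank_eq (hn0 : n ≠ 0) (hW : ∃ C : VariableChange ℚ, C • congruentNumberCurve n = W) :
    W.analyticRank = (congruentNumberCurve n).analyticRank := by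
  obtain ⟨C, hC⟩ := hW
  haveI := isElliptic_congruentNumberCurve hn0
  rw [← hC]
  exact analyticRank_variableChange_holds (congruentNumberCurve n) C

/-- A model of `E_n` (`n ≠ 0`) has CM (`j = 1728`, `ℤ[i]`). [cite: Cox2013, §5.B Prop. 5.16 and Cor. 5.17] -/
theorem hasCM (hn0 : n ≠ 0) (hW : ∃ C : VariableChange ℚ, C • congruentNumberCurve n = W) :
    W.HasCM :=
  X12.CongruentNumber.hasCM hn0 (exists_smul_eq_comm.1 hW)

/-- **`2` is RAMIFIED in the CM field `ℚ(i)`** of a model of `E_n` (`d_K = −4`): the S2 companions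
of the leaf sit in the ramified sub-leaf `WAllCornerFTwoRamified`. [cite: Cox2013, §5.B Prop. 5.16 and Cor. 5.17] -/
theorem cmRamified_two (hn0 : n ≠ 0) (hW : ∃ C : VariableChange ℚ, C • congruentNumberCurve n = W) :
    CMRamified W 2 := by
  rw [CMRamified, X12.CongruentNumber.cmFieldDiscrOfJ_eq hn0 (exists_smul_eq_comm.1 hW)]
  norm_num

/-- … hence `2` is a BAD prime of every model of `E_n` (`X12.not_good_two_of_cmRamified_two`).
[cite: SilvermanAEC2009, VII.5 Prop. 5.1] -/
theorem not_good_two [W.IsGloballyMinimal] (hn0 : n ≠ 0)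
    (hW : ∃ C : VariableChange ℚ, C • congruentNumberCurve n = W) : ¬ Good W 2 :=
  X12.not_good_two_of_cmRamified_two W (hasCM hn0 hW) (cmRamified_two hn0 hW)

/-- **Leaf membership of a model of `E_n` at `2` is EXACTLY `r_an(E_n) = 1`** — the one binder the
print facts supply (Tian 2014 Thm. 1.3 / Li–Liu–Tian 2024 Thm. 1.2: "analytic rank `1`"). [folklore] -/
theorem cornerF_two_iff (hn0 : n ≠ 0) (hW : ∃ C : VariableChange ℚ, C • congruentNumberCurve n = W) :
    CornerF W 2 ↔ (congruentNumberCurve n).analyticRank = 1 := by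
  rw [cornerF_two_iff_of_hasCM (hasCM hn0 hW), analyticRank_eq hn0 hW]

omit [W.IsElliptic] in
/-- **FACT-FREE MODEL TRANSPORT**: for `W` globally minimal with `C • E_n = W`, `n` square-free
(so `E_n = ⟨0,0,0,−n²,0⟩` is itself globally minimal, `isGloballyMinimal_congruentNumberCurve`),
`BSDp W p ↔ BSDp (congruentNumberCurve n) p` at EVERY `p`. No Cassels / GZK / modularity.
[cite: Miller2011LMS, Def. 1.1 (arXiv:1010.2431 p. 3)] -/
theorem bsdp_iff [W.IsGloballyMinimal] (hn : Squarefree n)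
    (hW : ∃ C : VariableChange ℚ, C • congruentNumberCurve n = W) (p : ℕ) :
    BSDp W p ↔ BSDp (congruentNumberCurve n) p := by
  obtain ⟨C, hC⟩ := hW
  haveI := isElliptic_congruentNumberCurve hn.ne_zero
  haveI := isGloballyMinimal_congruentNumberCurve hn
  exact bsdp_iff_of_smul_eq_of_isGloballyMinimal hC p

omit [W.IsElliptic] in
/-- All primes at once: `(∀ p, BSDp W p) ↔ (∀ p, BSDp (congruentNumberCurve n) p)`. Fact-free.
[cite: Miller2011LMS, Def. 1.1 (arXiv:1010.2431 p. 3)] -/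
theorem forall_bsdp_iff [W.IsGloballyMinimal] (hn : Squarefree n)
    (hW : ∃ C : VariableChange ℚ, C • congruentNumberCurve n = W) :
    (∀ p : ℕ, p.Prime → BSDp W p) ↔ ∀ p : ℕ, p.Prime → BSDp (congruentNumberCurve n) p :=
  forall₂_congr fun p _ => bsdp_iff hn hW p

omit [W.IsElliptic] in
/-- **The shape every `E_n` print fact is consumed in** (p1's §1 helper, now fact-free): if
`r_an(E_n) = 1` and `BSD(E_n, 2)` on the NAMED model (`n` square-free), then every globally minimal
`W` with `C • E_n = W` has analytic rank `1` and satisfies `BSD(W, 2)`.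
[cite: Miller2011LMS, Def. 1.1 (arXiv:1010.2431 p. 3)] -/
theorem analyticRank_eq_one_and_bsdp_two_of_smul [W.IsGloballyMinimal] (hn : Squarefree n)
    (h : (congruentNumberCurve n).analyticRank = 1 ∧ BSDp (congruentNumberCurve n) 2)
    {C : VariableChange ℚ} (hC : C • congruentNumberCurve n = W) :
    W.analyticRank = 1 ∧ BSDp W 2 :=
  ⟨(analyticRank_eq hn.ne_zero ⟨C, hC⟩).trans h.1, (bsdp_iff hn ⟨C, hC⟩ 2).2 h.2⟩

omit [W.IsElliptic] in
/-- The same with membership written `C • W = E_n` (`X12.CongruentNumber` orientation).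
[cite: Miller2011LMS, Def. 1.1 (arXiv:1010.2431 p. 3)] -/
theorem bsdp_iff_of_model [W.IsGloballyMinimal] (hn : Squarefree n)
    (hW : ∃ C : VariableChange ℚ, C • W = congruentNumberCurve n) (p : ℕ) :
    BSDp W p ↔ BSDp (congruentNumberCurve n) p :=
  bsdp_iff hn (exists_smul_eq_comm.2 hW) p

/-- `CornerF W 2 ↔ r_an(E_n) = 1` with membership written `C • W = E_n`. [folklore] -/
theorem cornerF_two_iff_of_model (hn0 : n ≠ 0)
    (hW : ∃ C : VariableChange ℚ, C • W = congruentNumberCurve n) :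
    CornerF W 2 ↔ (congruentNumberCurve n).analyticRank = 1 :=
  cornerF_two_iff hn0 (exists_smul_eq_comm.2 hW)

/-! ### Square-free normalisation: every `y² = x³ − m²x` (`m ∈ ℚˣ`) is a model of some `E_n`, `n` square-free

The printed `E_n`-facts take `n` a square-free positive integer, while a curve with `j = 1728` and
full rational `2`-torsion arrives as `y² = x³ − m²x` with `m ∈ ℚˣ` (`exists_smul_eq_of_j_eq_1728` gives
`y² = x³ + Ax`; full `2`-torsion means `−A ∈ ℚˣ²`). The twists of `j = 1728` are the `y² = x³ + Dx`,
`D ∈ ℚˣ/ℚˣ⁴` (Silverman *AEC* X.5.4), and `−m² ≡ −n² (mod ℚˣ⁴)` for `n` the square-free part of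
`|num m| · den m`. -/

omit [W.IsElliptic] in
/-- **Square-free normalisation.** If `C • W = ⟨0, 0, 0, −m², 0⟩` with `m ≠ 0`, then `W` is a
`ℚ`-model of the congruent-number curve `E_n` for a SQUARE-FREE `n ≥ 1` (namely the square-free part
of `|num m| · den m`; the rescaling is `u = den m / c` where `|num m| · den m = c² n`). Hence every
printed `E_n`-fact (stated for square-free `n`) reaches such `W` through `CongruentNumber.bsdp_iff`.
[cite: SilvermanAEC2009, X.5 Prop. 5.4 (iii)] -/
theorem exists_smul_congruentNumberCurve_of_smul_eq_neg_sq {m : ℚ} (hm : m ≠ 0)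
    {C : VariableChange ℚ} (hC : C • W = ⟨0, 0, 0, -m ^ 2, 0⟩) :
    ∃ n : ℕ, Squarefree n ∧ ∃ C' : VariableChange ℚ, C' • congruentNumberCurve n = W := by
  -- `a = |num m|`, `b = den m`, `a b = c² n` with `n` square-free
  obtain ⟨n, c, hcn, hn⟩ := Nat.sq_mul_squarefree (m.num.natAbs * m.den)
  have ha0 : 0 < m.num.natAbs := Int.natAbs_pos.mpr (Rat.num_ne_zero.mpr hm)
  have hb0 : 0 < m.den := m.den_pos
  have hab0 : 0 < m.num.natAbs * m.den := Nat.mul_pos ha0 hb0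
  have hc0 : c ≠ 0 := by
    rintro rfl
    rw [zero_pow two_ne_zero, zero_mul] at hcn
    omega
  -- the rescaling `u = b / c`
  have hu0 : ((m.den : ℚ) / c) ≠ 0 :=
    div_ne_zero (Nat.cast_ne_zero.mpr hb0.ne') (Nat.cast_ne_zero.mpr hc0)
  set D : VariableChange ℚ := ⟨Units.mk0 _ hu0, 0, 0, 0⟩ with hD
  -- the arithmetic identity `(c/b)⁴ n² = m²`
  have hcnQ : ((c : ℚ)) ^ 2 * n = (m.num.natAbs : ℚ) * m.den := by exact_mod_cast hcn
  have habs' : ((m.num.natAbs : ℕ) : ℚ) ^ 2 = (m.num : ℚ) ^ 2 := by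
    rw [Nat.cast_natAbs, Int.cast_abs, sq_abs]
  have hm2 : m ^ 2 = (m.num : ℚ) ^ 2 / (m.den : ℚ) ^ 2 := by
    conv_lhs => rw [← Rat.num_div_den m]
    rw [div_pow]
  have hbQ : (m.den : ℚ) ≠ 0 := Nat.cast_ne_zero.mpr hb0.ne'
  have hcQ : (c : ℚ) ≠ 0 := Nat.cast_ne_zero.mpr hc0
  have key : ((m.den : ℚ) / c)⁻¹ ^ 4 * (-((n : ℚ) ^ 2)) = -m ^ 2 := by
    calc ((m.den : ℚ) / c)⁻¹ ^ 4 * (-((n : ℚ) ^ 2))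
        = -(((c : ℚ) ^ 2 * n) ^ 2 / (m.den : ℚ) ^ 4) := by rw [inv_div, div_pow]; ring
      _ = -(((m.num.natAbs : ℚ) * m.den) ^ 2 / (m.den : ℚ) ^ 4) := by rw [hcnQ]
      _ = -(((m.num.natAbs : ℕ) : ℚ) ^ 2 / (m.den : ℚ) ^ 2) := by
          congr 1
          field_simp
      _ = -m ^ 2 := by rw [hm2, habs']
  have hDE : D • congruentNumberCurve n = ⟨0, 0, 0, -m ^ 2, 0⟩ := by
    ext
    · simp [hD, congruentNumberCurve, WeierstrassCurve.variableChange_a₁]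
    · simp [hD, congruentNumberCurve, WeierstrassCurve.variableChange_a₂]
    · simp [hD, congruentNumberCurve, WeierstrassCurve.variableChange_a₃]
    · simp only [hD, congruentNumberCurve, WeierstrassCurve.variableChange_a₄, Units.val_inv_eq_inv_val,
        Units.val_mk0]
      rw [← key]; ring
    · simp [hD, congruentNumberCurve, WeierstrassCurve.variableChange_a₆]
  refine ⟨n, hn, C⁻¹ * D, ?_⟩
  rw [mul_smul, hDE, ← hC, inv_smul_smul]

end CongruentNumber

/-! ### The Li–Liu–Tian family in LEAF SHAPE, one displayed fact -/

/-- **Li–Liu–Tian 2024 Thm. 1.2 closes the leaf on the LLT family, displaying ONLY that fact**: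
for every globally minimal `W` with CM and `ord_{s=1} L(E,s) = 1` (the leaf — both hypotheses are
implied by family membership and carried only to match `WAllCornerFTwo`) which is a model of `E_n`,
`n ≡ 5 (mod 8)` square-free, all prime factors `≡ 1 (mod 4)`, `ℚ(√−n)` without an ideal class of
order `4` (`P2.CongruentFamilyLLT W`, the printed hypotheses verbatim): `BSD(E, 2)`. The sub-lane's
`P2.bsdTwoOn_congruentFamilyLLT` displays in addition GZK, Cassels and modularity for the model
transport; here the transport is the fact-free `CongruentNumber.bsdp_iff`.
[cite: LiLiuTian2024, Thm. 1.2 (arXiv:1605.01481 §1, p. 2)] [cite: Tian2023CongruentICM, Thm. 2 (p. 1993)] -/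
theorem bsdp_two_of_cornerF_of_congruentFamilyLLT (hLLT : LiLiuTian2024.thm12_bsd_congruentNumberCurve) :
    ∀ (W : WeierstrassCurve ℚ) [W.IsElliptic] [W.IsGloballyMinimal],
      CornerF W 2 → CongruentFamilyLLT W → BSDp W 2 := by
  intro W _ _ _ hW
  obtain ⟨n, hsq, h8, hq, hcl, C, hC⟩ := hW
  haveI := isElliptic_congruentNumberCurve (Squarefree.ne_zero hsq)
  haveI := isGloballyMinimal_congruentNumberCurve hsq
  have h₀ : BSDp (congruentNumberCurve n) 2 :=
    LiLiuTian2024.forall_bsdp_congruentNumberCurve_of_thm12 hLLT hsq h8 hq hcl 2 Nat.prime_two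
  exact (bsdp_iff_of_smul_eq_of_isGloballyMinimal hC 2).2 h₀

/-- **Full BSD, every prime, on the LLT family, for every globally minimal model — ONE fact.**
[cite: LiLiuTian2024, Thm. 1.2 (arXiv:1605.01481 §1, p. 2)] -/
theorem forall_bsdp_of_congruentFamilyLLT (hLLT : LiLiuTian2024.thm12_bsd_congruentNumberCurve)
    (W : WeierstrassCurve ℚ) [W.IsElliptic] [W.IsGloballyMinimal] (hW : CongruentFamilyLLT W)
    (p : ℕ) (hp : p.Prime) : BSDp W p := by
  obtain ⟨n, hsq, h8, hq, hcl, C, hC⟩ := hW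
  haveI := isElliptic_congruentNumberCurve (Squarefree.ne_zero hsq)
  haveI := isGloballyMinimal_congruentNumberCurve hsq
  exact (bsdp_iff_of_smul_eq_of_isGloballyMinimal hC p).2
    (LiLiuTian2024.forall_bsdp_congruentNumberCurve_of_thm12 hLLT hsq h8 hq hcl p hp)

/-- **Members of the LLT family ARE in the leaf** (CM, `r_an = 1` by the printed theorem):
`CornerF W 2`. [cite: LiLiuTian2024, Thm. 1.2 (arXiv:1605.01481 §1, p. 2)] -/
theorem cornerF_two_of_congruentFamilyLLT (hLLT : LiLiuTian2024.thm12_bsd_congruentNumberCurve)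
    (W : WeierstrassCurve ℚ) [W.IsElliptic] [W.IsGloballyMinimal] (hW : CongruentFamilyLLT W) :
    CornerF W 2 := by
  obtain ⟨hcm, -, hr, -⟩ := cornerFSharp_of_congruentFamilyLLT hLLT W hW
  exact ⟨hcm, hr, Or.inl rfl⟩

/-- **The sub-lane's class door with the transport facts removed**: `BSDTwoOn CongruentFamilyLLT`
from Li–Liu–Tian Thm. 1.2 ALONE (compare `P2.bsdTwoOn_congruentFamilyLLT`, which also displays
`hGZK`, `hCassels`, `hmod`). [cite: LiLiuTian2024, Thm. 1.2 (arXiv:1605.01481 §1, p. 2)] -/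
theorem bsdTwoOn_congruentFamilyLLT' (hLLT : LiLiuTian2024.thm12_bsd_congruentNumberCurve) :
    BSDTwoOn CongruentFamilyLLT :=
  fun W _ _ _ hW => forall_bsdp_of_congruentFamilyLLT hLLT W hW 2 Nat.prime_two

/-! ## §2 S2b companions: globally minimal models of the cube-sum curves `C_p : x³ + y³ = p` -/

namespace Sylvester

open X12.Sylvester

variable {p : ℕ} {B : WeierstrassCurve ℚ} [B.IsElliptic]

/-- **Leaf membership of a model of `C_p` at `2` is EXACTLY `r_an = 1`** (CM by `ℤ[ζ₃]`, `j = 0`).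
[folklore] -/
theorem cornerF_two_iff (hB : ∃ C : VariableChange ℚ, C • B = cubeSumCurve (p : ℚ)) :
    CornerF B 2 ↔ B.analyticRank = 1 :=
  cornerF_two_iff_of_hasCM (hasCM_of_model B hB)

/- `2` is NOT split (inert) in `K = ℚ(√−3)` for a model of `C_p`: cite the landed
`X12.Sylvester.not_cmSplit_two_of_model B hB` (the S2b companions sit in the INERT sub-leaf). -/

omit [B.IsElliptic] in
/-- A model `B` of `C_p` and the named minimal model `sylvesterCurve p = [0,0,p,0,−7p²]` differ by a
change of variables: `(C'⁻¹ * C) • B = sylvesterCurve p` from `C • B = cubeSumCurve p = C' • sylvesterCurve p`.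
[folklore] -/
theorem exists_smul_eq_sylvesterCurve (hB : ∃ C : VariableChange ℚ, C • B = cubeSumCurve (p : ℚ)) :
    ∃ C : VariableChange ℚ, C • B = sylvesterCurve p := by
  obtain ⟨C, hC⟩ := hB
  obtain ⟨C', hC'⟩ := exists_smul_sylvesterCurve p
  refine ⟨C'⁻¹ * C, ?_⟩
  rw [mul_smul, hC, ← hC', inv_smul_smul]

/-- **FACT-FREE MODEL TRANSPORT to the named minimal model**: for `B` globally minimal with
`C • B = cubeSumCurve p`, `p` prime `≠ 3` (so `sylvesterCurve p` is globally minimal,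
`isGloballyMinimal_sylvesterCurve`): `BSDp B q ↔ BSDp (sylvesterCurve p) q` at every `q`.
[cite: Miller2011LMS, Def. 1.1 (arXiv:1010.2431 p. 3)] -/
theorem bsdp_iff_sylvesterCurve [B.IsGloballyMinimal] (hp : p.Prime) (hp3 : p ≠ 3)
    (hB : ∃ C : VariableChange ℚ, C • B = cubeSumCurve (p : ℚ)) (q : ℕ) :
    BSDp B q ↔ BSDp (sylvesterCurve p) q := by
  obtain ⟨C, hC⟩ := exists_smul_eq_sylvesterCurve hB
  haveI := isGloballyMinimal_sylvesterCurve hp hp3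
  exact (bsdp_iff_of_smul_eq_of_isGloballyMinimal hC q).symm

/-- **RUNG LEAF K7t ON THE NAMED MODEL.** `X12.CMAtTwo` (`BSD(B, 2)` for EVERY globally minimal
model `B` of `C_p`, `p ≡ 4, 7 (mod 9)` prime, `3` not a cube mod `p`) is EQUIVALENT to the same
statement for the single named model `sylvesterCurve p` — what a closer of K7t has to prove, and what
a certificate / print theorem at `2` would be read on. Fact-free. [cite: HuShuYin2019, Thm. 1.4]
[cite: Miller2011LMS, Def. 1.1 (arXiv:1010.2431 p. 3)] -/
theorem cmAtTwo_iff_sylvesterCurve :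
    X12.CMAtTwo ↔
      ∀ (p : ℕ), p.Prime → (p % 9 = 4 ∨ p % 9 = 7) → (¬ ∃ x : ZMod p, x ^ 3 = 3) →
        BSDp (sylvesterCurve p) 2 := by
  constructor
  · intro h p hp h9 h3
    haveI := isElliptic_sylvesterCurve hp.ne_zero
    haveI := isGloballyMinimal_sylvesterCurve hp (by omega)
    exact h p hp h9 h3 (sylvesterCurve p) (exists_smul_sylvesterCurve p)
  · intro h p hp h9 h3 B _ _ hB
    exact (bsdp_iff_sylvesterCurve hp (by omega) hB 2).2 (h p hp h9 h3)

/-- **The shape a future `2`-adic fact for `C_p` is consumed in**: `BSD(sylvesterCurve p, 2)` on the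
named model ⇒ `BSD(B, 2)` for every globally minimal model `B` in the leaf. Fact-free glue.
[cite: Miller2011LMS, Def. 1.1 (arXiv:1010.2431 p. 3)] -/
theorem bsdp_two_of_named [B.IsGloballyMinimal] (hp : p.Prime) (hp3 : p ≠ 3)
    (hB : ∃ C : VariableChange ℚ, C • B = cubeSumCurve (p : ℚ))
    (h : BSDp (sylvesterCurve p) 2) : BSDp B 2 :=
  (bsdp_iff_sylvesterCurve hp hp3 hB 2).2 h

end Sylvester

end Summit.BirchSwinnertonDyer.Rank1Residual.P2.CornerFTwo

end
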